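import Summits.HubbardSuperconductivity.HubbardSuperconductivity.Theorems.ThermalWedgeTwSeededEnsembleEquivalenceRFreeSourcedPressureFormula
import Literature.MathematicalPhysics.QuantumLattice.DWaveSourceLeeYang
import Literature.MathematicalPhysics.QuantumLattice.DWaveSourceProofs
import Literature.MathematicalPhysics.QuantumLattice.TransverseWardIdentity
import Literature.Analysis.SpecialFunctions.MatsubaraSum

/-!
# Crux `TwSeededEnsembleEquivalenceR` (stmt-HubbardSuperconductivity-15581), line `cold-floor-collapse` (slug `Sketch`),
# skeleton v10 — the FREE truncated anomalous pair correlator in CLOSED FORM (Matsubara representation)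

Support file (`--supports stmt-HubbardSuperconductivity-15581`; sorry-free; no definition; route-file free).

The registered physics stub of skeleton v10 (`stub_fvDeepAnomalousSign`, lead c11) is the SIGN of one truncated
two-point function of the `d`-wave–sourced Hubbard torus at the cold slice,
`Re (Δ_d,Δ_d)_{Duh} ≤ (Re⟨Δ_d⟩)²`. Any perturbative proof of it compares the interacting correlator with the FREE
one and needs the free SIGNAL quantitatively (not only its sign, `cal_freeAnomalousSign_finiteVolume`). This file
computes the free correlator exactly: for `β > 0`, any `μ`, `L ≥ 3` and `h > 0`,

  `(Re⟨Δ_d⟩)² − Re (Δ_d,Δ_d)_{Duh; β, dWaveSourceTorus L 0 μ h}`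
  `   = (128 h²/β²) · Σ_k ĝ_d(k)⁴ · Σ_{n ≥ 0} 1/(ωₙ² + E_k²)²`,

`ωₙ = (2n+1)π/β` the fermionic Matsubara frequencies, `ξ_k = ε_L(k) − μ`, `ĝ_d(k) = cos k₁ − cos k₂`,
`E_k² = ξ_k² + 8h²ĝ_d(k)²` the BdG energies (`fam_freeAnomalousMargin_eq`) — a manifestly POSITIVE double sum,
monotone in the gap. Ingredients (all in the tree): the BdG mode sum of the free sourced torus
(`twR_log_partitionFn_free_eq`), the Matsubara sum `Σ_{n≥0} 1/(ωₙ²+E²) = β tanh(βE/2)/(4E)`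
(`tsum_one_div_matsubara_sq_add_sq`), the Dyson–Lieb–Simon derivative `d/dt log Z = β Re⟨Φ₁⟩`, linear response
`d/dt Re⟨Φ₁⟩ = β[Re(Φ₁,Φ₁) − (Re⟨Φ₁⟩)²]`, the transverse Ward identity `β Re(Φ₂,Φ₂) = Re⟨Φ₁⟩/h` and
`χ∥ − χ⊥ = 4·[Re(Δ,Δ) − (Re⟨Δ⟩)²]` (`TransverseWardIdentity.lean`): per mode,
`g(t) = log((1 + cosh βE(t))/2)` has `g′(t) = 32ĝ²t·S₁(E²)`, `g″(h) − g′(h)/h = −512 ĝ⁴h²·S₂(E²)` with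
`S_p(u) = Σₙ (ωₙ² + u)^{-p}`, and `4·[Re(Δ,Δ) − (Re⟨Δ⟩)²] = β⁻²·Σ_k [g_k″(h) − g_k′(h)/h]`.
The companion file `…RFreeAnomalousMargin.lean` bounds the double sum below by `c·L²/β` uniformly in `L`
(the quantitative `U = 0` margin of DEEP-SIGN). [folklore: the BdG anomalous bubble in Matsubara form]
-/

set_option linter.dupNamespace false

noncomputable section

namespace Summit.HubbardSuperconductivity.HubbardSuperconductivity.Theorems.TwSeededEnsembleEquivalenceR

open Real Set Matrix Finset Filter Literature.MathematicalPhysics.QuantumLattice Literature.Probability.LatticeModels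
  Literature.Analysis.SpecialFunctions
open scoped ComplexOrder Topology

/-! ### Matsubara sums `S₁(u) = Σₙ (ωₙ² + u)⁻¹`, `S₂(u) = Σₙ (ωₙ² + u)⁻²` -/

/-- The fermionic Matsubara frequencies are at least `π/β`. [folklore] -/
theorem fam_matsubaraFreq_ge {β : ℝ} (hβ : 0 < β) (n : ℕ) : π / β ≤ (2 * n + 1) * π / β := by
  rw [div_le_div_iff_of_pos_right hβ]
  have hn : (0 : ℝ) ≤ n := n.cast_nonneg
  nlinarith [Real.pi_pos]

/-- The fermionic Matsubara frequencies are positive. [folklore] -/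
theorem fam_matsubaraFreq_pos {β : ℝ} (hβ : 0 < β) (n : ℕ) : 0 < (2 * n + 1) * π / β :=
  lt_of_lt_of_le (div_pos Real.pi_pos hβ) (fam_matsubaraFreq_ge hβ n)

/-- Summability of `(ωₙ² + u)⁻¹` for `u ≥ 0`. [folklore] -/
theorem fam_summable_S1 {β : ℝ} (hβ : 0 < β) {u : ℝ} (hu : 0 ≤ u) :
    Summable fun n : ℕ => 1 / (((2 * n + 1) * π / β) ^ 2 + u) := by
  have h := summable_one_div_matsubara_sq_add_sq hβ (Real.sqrt u)
  simp_rw [Real.sq_sqrt hu] at h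
  exact h

/-- Summability of `ωₙ⁻⁴`. [folklore] -/
theorem fam_summable_inv_pow_four {β : ℝ} (hβ : 0 < β) :
    Summable fun n : ℕ => 1 / (((2 * n + 1) * π / β) ^ 2) ^ 2 := by
  have h0 := (fam_summable_S1 hβ le_rfl).mul_left ((β / π) ^ 2)
  refine Summable.of_nonneg_of_le (fun n => by positivity) (fun n => ?_) h0
  have hω := fam_matsubaraFreq_pos hβ n
  have hge := fam_matsubaraFreq_ge hβ n
  have hπβ : 0 < π / β := div_pos Real.pi_pos hβ
  rw [add_zero]
  set ω : ℝ := (2 * n + 1) * π / β with hω_def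
  have hω2 : 0 < ω ^ 2 := by positivity
  have h3 : 1 ≤ β / π * ω :=
    calc (1 : ℝ) = β / π * (π / β) := by field_simp
      _ ≤ β / π * ω := by gcongr
  have h1 : 1 ≤ (β / π) ^ 2 * ω ^ 2 := by rw [← mul_pow]; exact one_le_pow₀ h3
  calc 1 / (ω ^ 2) ^ 2 = 1 / ω ^ 2 * (1 / ω ^ 2) := by rw [one_div_mul_one_div, ← sq]
    _ ≤ (β / π) ^ 2 * (1 / ω ^ 2) := by
        gcongr
        rw [div_le_iff₀ hω2]
        exact h1

/-- Summability of `(ωₙ² + u)⁻²` for `u ≥ 0`. [folklore] -/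
theorem fam_summable_S2 {β : ℝ} (hβ : 0 < β) {u : ℝ} (hu : 0 ≤ u) :
    Summable fun n : ℕ => 1 / (((2 * n + 1) * π / β) ^ 2 + u) ^ 2 := by
  refine Summable.of_nonneg_of_le (fun n => by positivity) (fun n => ?_) (fam_summable_inv_pow_four hβ)
  have hω := fam_matsubaraFreq_pos hβ n
  gcongr
  linarith

/-- **`S₁′ = −S₂`**: term-by-term differentiation of the Matsubara sum on `u > 0`. [folklore] -/
theorem fam_hasDerivAt_S1 {β : ℝ} (hβ : 0 < β) {u : ℝ} (hu : 0 < u) :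
    HasDerivAt (fun v : ℝ => ∑' n : ℕ, 1 / (((2 * n + 1) * π / β) ^ 2 + v))
      (-(∑' n : ℕ, 1 / (((2 * n + 1) * π / β) ^ 2 + u) ^ 2)) u := by
  have hderiv : ∀ (n : ℕ) (y : ℝ), y ∈ Ioi (0 : ℝ) →
      HasDerivAt (fun v : ℝ => 1 / (((2 * n + 1) * π / β) ^ 2 + v))
        (-(1 / (((2 * n + 1) * π / β) ^ 2 + y) ^ 2)) y := by
    intro n y hy
    have hy' : 0 < y := hy
    have hω := fam_matsubaraFreq_pos hβ n
    have hne : ((2 * n + 1) * π / β) ^ 2 + y ≠ 0 := by positivity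
    have h1 : HasDerivAt (fun v : ℝ => ((2 * n + 1) * π / β) ^ 2 + v) 1 y := (hasDerivAt_id y).const_add _
    have h2 := h1.inv hne
    have hf : (fun v : ℝ => 1 / (((2 * n + 1) * π / β) ^ 2 + v)) = fun v => (((2 * n + 1) * π / β) ^ 2 + v)⁻¹ := by
      funext v; exact one_div _
    rw [hf]
    refine h2.congr_deriv ?_
    rw [neg_div]
  have hbound : ∀ (n : ℕ) (y : ℝ), y ∈ Ioi (0 : ℝ) →
      ‖-(1 / (((2 * n + 1) * π / β) ^ 2 + y) ^ 2)‖ ≤ 1 / (((2 * n + 1) * π / β) ^ 2) ^ 2 := by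
    intro n y hy
    have hy' : 0 < y := hy
    have hω := fam_matsubaraFreq_pos hβ n
    rw [norm_neg, Real.norm_eq_abs, abs_of_nonneg (by positivity)]
    gcongr
    linarith
  have h := hasDerivAt_tsum_of_isPreconnected (fam_summable_inv_pow_four hβ) isOpen_Ioi isPreconnected_Ioi
    hderiv hbound hu (fam_summable_S1 hβ hu.le) hu
  rw [tsum_neg] at h
  exact h

/-- `S₂` is antitone in `u ≥ 0`. [folklore] -/
theorem fam_S2_antitone {β : ℝ} (hβ : 0 < β) {u v : ℝ} (hu : 0 ≤ u) (huv : u ≤ v) :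
    ∑' n : ℕ, 1 / (((2 * n + 1) * π / β) ^ 2 + v) ^ 2 ≤ ∑' n : ℕ, 1 / (((2 * n + 1) * π / β) ^ 2 + u) ^ 2 := by
  refine Summable.tsum_le_tsum (fun n => ?_) (fam_summable_S2 hβ (hu.trans huv)) (fam_summable_S2 hβ hu)
  have hω := fam_matsubaraFreq_pos hβ n
  gcongr

/-- `S₂(u) ≥ 0`. [folklore] -/
theorem fam_S2_nonneg (β u : ℝ) : 0 ≤ ∑' n : ℕ, 1 / (((2 * n + 1) * π / β) ^ 2 + u) ^ 2 :=
  tsum_nonneg fun n => by positivity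

/-! ### Per-mode calculus -/

/-- The squared source term of the BdG energy: `(2√2·t·ĝ)² = 8ĝ²t²`. [folklore] -/
theorem fam_gapTerm_sq (t d : ℝ) : (2 * Real.sqrt 2 * t * d) ^ 2 = 8 * d ^ 2 * t ^ 2 := by
  have h2 : Real.sqrt 2 ^ 2 = 2 := Real.sq_sqrt (by norm_num)
  calc (2 * Real.sqrt 2 * t * d) ^ 2 = 4 * Real.sqrt 2 ^ 2 * t ^ 2 * d ^ 2 := by ring
    _ = 8 * d ^ 2 * t ^ 2 := by rw [h2]; ring

/-- **First `t`-derivative of a BdG mode** `g(t) = log((1 + cosh(β√(ξ² + (2√2 t ĝ)²)))/2)` at `t > 0`: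
`g′(t) = 32 ĝ² t · Σₙ 1/(ωₙ² + ξ² + 8ĝ²t²)` (chain rule, `sinh/(1+cosh) = tanh(·/2)` and the Matsubara sum
`β tanh(βE/2)/E = 4 Σₙ 1/(ωₙ² + E²)`). [folklore] -/
theorem fam_hasDerivAt_mode {β : ℝ} (hβ : 0 < β) (ξ d : ℝ) {t : ℝ} (ht : 0 < t) :
    HasDerivAt (fun s : ℝ => Real.log ((1 + Real.cosh (β * Real.sqrt (ξ ^ 2 + (2 * Real.sqrt 2 * s * d) ^ 2))) / 2))
      (32 * d ^ 2 * t * ∑' n : ℕ, 1 / (((2 * n + 1) * π / β) ^ 2 + (ξ ^ 2 + 8 * d ^ 2 * t ^ 2))) t := by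
  by_cases hd : d = 0
  · subst hd
    have hfun : (fun s : ℝ => Real.log ((1 + Real.cosh (β * Real.sqrt (ξ ^ 2 + (2 * Real.sqrt 2 * s * 0) ^ 2))) / 2)) =
        fun _ => Real.log ((1 + Real.cosh (β * Real.sqrt (ξ ^ 2))) / 2) := by
      funext s; simp
    rw [hfun]
    simpa using hasDerivAt_const t (Real.log ((1 + Real.cosh (β * Real.sqrt (ξ ^ 2))) / 2))
  -- `u(s) = ξ² + 8 d² s²`, positive at `t`
  have hd2 : 0 < d ^ 2 := by positivity
  set u : ℝ → ℝ := fun s => ξ ^ 2 + 8 * d ^ 2 * s ^ 2 with hu_def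
  have hut : 0 < u t := by simp only [hu_def]; positivity
  have hfun : (fun s : ℝ => Real.log ((1 + Real.cosh (β * Real.sqrt (ξ ^ 2 + (2 * Real.sqrt 2 * s * d) ^ 2))) / 2)) =
      fun s => Real.log ((1 + Real.cosh (β * Real.sqrt (u s))) / 2) := by
    funext s; simp only [hu_def, fam_gapTerm_sq]
  rw [hfun]
  -- derivative of `u` and of `E = √u`
  have hu' : HasDerivAt u (16 * d ^ 2 * t) t := by
    have h1 : HasDerivAt (fun s : ℝ => s ^ 2) (2 * t) t := by simpa using hasDerivAt_pow 2 t
    have h2 := (h1.const_mul (8 * d ^ 2)).const_add (ξ ^ 2)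
    exact h2.congr_deriv (by ring)
  set E : ℝ := Real.sqrt (u t) with hE_def
  have hEpos : 0 < E := Real.sqrt_pos.2 hut
  have hE2 : E ^ 2 = u t := Real.sq_sqrt hut.le
  have hsqrt : HasDerivAt (fun s => Real.sqrt (u s)) (16 * d ^ 2 * t / (2 * E)) t := by
    have h := (Real.hasDerivAt_sqrt hut.ne').comp t hu'
    refine h.congr_deriv ?_
    rw [hE_def]; ring
  -- derivative of `E ↦ log((1 + cosh(βE))/2)`
  have hcosh_pos : 0 < (1 + Real.cosh (β * E)) / 2 := by
    have := Real.one_le_cosh (β * E); positivity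
  have hinner : HasDerivAt (fun s => (1 + Real.cosh (β * Real.sqrt (u s))) / 2)
      (β * Real.sinh (β * E) * (16 * d ^ 2 * t / (2 * E)) / 2) t := by
    have h1 : HasDerivAt (fun s => β * Real.sqrt (u s)) (β * (16 * d ^ 2 * t / (2 * E))) t := hsqrt.const_mul β
    have h2 := (Real.hasDerivAt_cosh (β * Real.sqrt (u t))).comp t h1
    have h3 := (h2.const_add 1).div_const 2
    refine h3.congr_deriv ?_
    rw [← hE_def]; ring
  have hlog := hinner.log hcosh_pos.ne'
  refine hlog.congr_deriv ?_
  rw [← hE_def]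
  -- simplify: `β sinh(βE)·(16d²t/(2E))/2 / ((1+cosh βE)/2) = 8d²t · β tanh(βE/2)/E = 32 d² t S₁(E²)`
  -- half-angle identity `sinh x/(1 + cosh x) = tanh(x/2)` (also in the tree as
  -- `TwSourcedCondensation.Negative.sinh_div_one_add_cosh`; re-derived locally to keep the imports light)
  have hhalf : ∀ x : ℝ, Real.sinh x / (1 + Real.cosh x) = Real.tanh (x / 2) := by
    intro x
    have hc : Real.cosh (x / 2) ≠ 0 := (Real.cosh_pos _).ne'
    have h1 : Real.sinh x = 2 * Real.sinh (x / 2) * Real.cosh (x / 2) := by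
      rw [← Real.sinh_two_mul]; ring_nf
    have h2 : 1 + Real.cosh x = 2 * Real.cosh (x / 2) ^ 2 := by
      have := Real.cosh_two_mul (x / 2)
      rw [show 2 * (x / 2) = x by ring] at this
      rw [this]; nlinarith [Real.cosh_sq (x / 2)]
    rw [h1, h2, Real.tanh_eq_sinh_div_cosh]
    field_simp
  have htanh : β * Real.sinh (β * E) * (16 * d ^ 2 * t / (2 * E)) / 2 / ((1 + Real.cosh (β * E)) / 2) =
      8 * d ^ 2 * t * (β * Real.tanh (β * E / 2) / E) := by
    rw [← hhalf]
    field_simp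
    ring
  have hM := tsum_one_div_matsubara_sq_add_sq hβ hEpos.ne'
  have hS : β * Real.tanh (β * E / 2) / E = 4 * ∑' n : ℕ, 1 / (((2 * n + 1) * π / β) ^ 2 + E ^ 2) := by
    rw [hM]; field_simp
  rw [htanh, hS, hE2]
  simp only [hu_def]
  ring

/-- **Second `t`-derivative of a BdG mode** at `h > 0`, in the form
`d/dt [32ĝ²t·S₁(ξ² + 8ĝ²t²)]|_{t=h} = 32ĝ²·S₁(E_h²) − 512ĝ⁴h²·S₂(E_h²)` (product rule and `S₁′ = −S₂`). [folklore] -/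
theorem fam_hasDerivAt_modeDeriv {β : ℝ} (hβ : 0 < β) (ξ d : ℝ) {h : ℝ} (hh : 0 < h) :
    HasDerivAt (fun t : ℝ => 32 * d ^ 2 * t * ∑' n : ℕ, 1 / (((2 * n + 1) * π / β) ^ 2 + (ξ ^ 2 + 8 * d ^ 2 * t ^ 2)))
      (32 * d ^ 2 * ∑' n : ℕ, 1 / (((2 * n + 1) * π / β) ^ 2 + (ξ ^ 2 + 8 * d ^ 2 * h ^ 2)) -
        512 * d ^ 4 * h ^ 2 * ∑' n : ℕ, 1 / (((2 * n + 1) * π / β) ^ 2 + (ξ ^ 2 + 8 * d ^ 2 * h ^ 2)) ^ 2) h := by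
  by_cases hd : d = 0
  · subst hd
    simp only [ne_eq, OfNat.ofNat_ne_zero, not_false_eq_true, zero_pow, mul_zero, zero_mul, sub_zero]
    exact hasDerivAt_const h 0
  have hd2 : 0 < d ^ 2 := by positivity
  set u : ℝ → ℝ := fun s => ξ ^ 2 + 8 * d ^ 2 * s ^ 2 with hu_def
  have huh : 0 < u h := by simp only [hu_def]; positivity
  have hu' : HasDerivAt u (16 * d ^ 2 * h) h := by
    have h1 : HasDerivAt (fun s : ℝ => s ^ 2) (2 * h) h := by simpa using hasDerivAt_pow 2 h
    have h2 := (h1.const_mul (8 * d ^ 2)).const_add (ξ ^ 2)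
    exact h2.congr_deriv (by ring)
  have hS1 := (fam_hasDerivAt_S1 hβ huh).comp h hu'
  have hprod := ((hasDerivAt_id h).mul hS1).const_mul (32 * d ^ 2)
  have key : HasDerivAt (fun t : ℝ => 32 * d ^ 2 * (t * ∑' n : ℕ, 1 / (((2 * n + 1) * π / β) ^ 2 + (ξ ^ 2 + 8 * d ^ 2 * t ^ 2))))
      (32 * d ^ 2 * ∑' n : ℕ, 1 / (((2 * n + 1) * π / β) ^ 2 + (ξ ^ 2 + 8 * d ^ 2 * h ^ 2)) -
        512 * d ^ 4 * h ^ 2 * ∑' n : ℕ, 1 / (((2 * n + 1) * π / β) ^ 2 + (ξ ^ 2 + 8 * d ^ 2 * h ^ 2)) ^ 2) h := by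
    refine hprod.congr_deriv ?_
    simp only [Function.comp_apply, id_eq, hu_def]
    ring
  have hf : (fun t : ℝ => 32 * d ^ 2 * t * ∑' n : ℕ, 1 / (((2 * n + 1) * π / β) ^ 2 + (ξ ^ 2 + 8 * d ^ 2 * t ^ 2))) =
      fun t : ℝ => 32 * d ^ 2 * (t * ∑' n : ℕ, 1 / (((2 * n + 1) * π / β) ^ 2 + (ξ ^ 2 + 8 * d ^ 2 * t ^ 2))) := by
    funext t; ring
  rw [hf]
  exact key

/-! ### The free sourced torus: source derivatives of `log Z` and of the pair amplitude -/

section Free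

variable {L : ℕ} [NeZero L]

/-- **`d/dt log Z` of the free sourced torus, explicitly**: for `L ≥ 3`, `β > 0`, `t > 0`,
`d/dt log Re Z_β(dWaveSourceTorus L 0 μ t) = Σ_k 32 ĝ_d(k)² t · S₁(ξ_k² + 8ĝ_d(k)²t²)` (mode by mode). [folklore] -/
theorem fam_hasDerivAt_logZ_free (hL : 3 ≤ L) {β : ℝ} (hβ : 0 < β) (μ : ℝ) {t : ℝ} (ht : 0 < t) :
    HasDerivAt (fun s : ℝ => Real.log (partitionFn β (dWaveSourceTorus L 0 μ s)).re)
      (∑ k : TorusSite 2 L, 32 * dWaveGap k ^ 2 * t *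
        ∑' n : ℕ, 1 / (((2 * n + 1) * π / β) ^ 2 + ((torusBand L k - μ) ^ 2 + 8 * dWaveGap k ^ 2 * t ^ 2))) t := by
  have hfun : (fun s : ℝ => Real.log (partitionFn β (dWaveSourceTorus L 0 μ s)).re) = fun s =>
      (2 * L ^ 2 : ℕ) * Real.log 2 + ∑ k : TorusSite 2 L, (-(β * (torusBand L k - μ)) +
        Real.log ((1 + Real.cosh (β * Real.sqrt ((torusBand L k - μ) ^ 2 +
          (2 * Real.sqrt 2 * s * dWaveGap k) ^ 2))) / 2)) := by
    funext s; exact twR_log_partitionFn_free_eq hL β μ s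
  rw [hfun]
  refine HasDerivAt.const_add _ ?_
  have hsum := HasDerivAt.fun_sum (u := Finset.univ) fun (k : TorusSite 2 L) _ =>
    (fam_hasDerivAt_mode hβ (torusBand L k - μ) (dWaveGap k) ht).const_add (-(β * (torusBand L k - μ)))
  exact hsum

/-- **Dyson–Lieb–Simon for the free sourced torus**: `β Re⟨Δ_d + Δ_d†⟩_{β, dWaveSourceTorus L 0 μ t}` is the
explicit mode sum `Σ_k 32 ĝ_d(k)² t · S₁(E_k(t)²)` (`t > 0`; uniqueness of the derivative of `log Z`). [folklore] -/
theorem fam_beta_mul_re_gibbsState_longitudinal_eq (hL : 3 ≤ L) {β : ℝ} (hβ : 0 < β) (μ : ℝ) {t : ℝ}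
    (ht : 0 < t) :
    β * (gibbsState β (dWaveSourceTorus L 0 μ t)
        (pairField dWaveFormFactor L + (pairField dWaveFormFactor L)ᴴ)).re =
      ∑ k : TorusSite 2 L, 32 * dWaveGap k ^ 2 * t *
        ∑' n : ℕ, 1 / (((2 * n + 1) * π / β) ^ 2 + ((torusBand L k - μ) ^ 2 + 8 * dWaveGap k ^ 2 * t ^ 2)) := by
  have h1 := hasDerivAt_log_partitionFn_sub_smul (isHermitian_hubbardTorusWith L 1 0 μ)
    (isHermitian_longitudinal (pairField dWaveFormFactor L)) hβ t
  have h2 := fam_hasDerivAt_logZ_free hL hβ μ ht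
  exact h1.unique h2

/-- **Linear response of the free pair amplitude, explicitly**: for `h > 0`,
`d/dt Re⟨Δ_d + Δ_d†⟩_{β, dWaveSourceTorus L 0 μ t}|_{t=h} = β⁻¹ Σ_k [32 ĝ² S₁(E_k²) − 512 ĝ⁴ h² S₂(E_k²)]`. [folklore] -/
theorem fam_hasDerivAt_re_gibbsState_longitudinal (hL : 3 ≤ L) {β : ℝ} (hβ : 0 < β) (μ : ℝ) {h : ℝ}
    (hh : 0 < h) :
    HasDerivAt (fun t : ℝ => (gibbsState β (dWaveSourceTorus L 0 μ t)
        (pairField dWaveFormFactor L + (pairField dWaveFormFactor L)ᴴ)).re)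
      (β⁻¹ * ∑ k : TorusSite 2 L, (32 * dWaveGap k ^ 2 *
          ∑' n : ℕ, 1 / (((2 * n + 1) * π / β) ^ 2 + ((torusBand L k - μ) ^ 2 + 8 * dWaveGap k ^ 2 * h ^ 2)) -
        512 * dWaveGap k ^ 4 * h ^ 2 *
          ∑' n : ℕ, 1 / (((2 * n + 1) * π / β) ^ 2 + ((torusBand L k - μ) ^ 2 + 8 * dWaveGap k ^ 2 * h ^ 2)) ^ 2)) h := by
  have hD : HasDerivAt (fun t : ℝ => β⁻¹ * ∑ k : TorusSite 2 L, 32 * dWaveGap k ^ 2 * t *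
      ∑' n : ℕ, 1 / (((2 * n + 1) * π / β) ^ 2 + ((torusBand L k - μ) ^ 2 + 8 * dWaveGap k ^ 2 * t ^ 2)))
      (β⁻¹ * ∑ k : TorusSite 2 L, (32 * dWaveGap k ^ 2 *
          ∑' n : ℕ, 1 / (((2 * n + 1) * π / β) ^ 2 + ((torusBand L k - μ) ^ 2 + 8 * dWaveGap k ^ 2 * h ^ 2)) -
        512 * dWaveGap k ^ 4 * h ^ 2 *
          ∑' n : ℕ, 1 / (((2 * n + 1) * π / β) ^ 2 + ((torusBand L k - μ) ^ 2 + 8 * dWaveGap k ^ 2 * h ^ 2)) ^ 2)) h := by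
    have hsum := HasDerivAt.fun_sum (u := Finset.univ) fun (k : TorusSite 2 L) _ =>
      fam_hasDerivAt_modeDeriv hβ (torusBand L k - μ) (dWaveGap k) hh
    exact hsum.const_mul β⁻¹
  have heq : (fun t : ℝ => (gibbsState β (dWaveSourceTorus L 0 μ t)
      (pairField dWaveFormFactor L + (pairField dWaveFormFactor L)ᴴ)).re) =ᶠ[𝓝 h]
      fun t : ℝ => β⁻¹ * ∑ k : TorusSite 2 L, 32 * dWaveGap k ^ 2 * t *
        ∑' n : ℕ, 1 / (((2 * n + 1) * π / β) ^ 2 + ((torusBand L k - μ) ^ 2 + 8 * dWaveGap k ^ 2 * t ^ 2)) := by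
    filter_upwards [Ioi_mem_nhds hh] with t ht
    have ht' : 0 < t := ht
    rw [← fam_beta_mul_re_gibbsState_longitudinal_eq hL hβ μ ht']
    field_simp
  exact hD.congr_of_eventuallyEq heq

/-- **The free truncated anomalous `d`-wave pair correlator in closed form.** For `β > 0`, any `μ`, `L ≥ 3`
and `h > 0`,

  `(Re⟨Δ_d⟩)² − Re (Δ_d,Δ_d)_{Duh; β, dWaveSourceTorus L 0 μ h} = (128 h²/β²) Σ_k ĝ_d(k)⁴ Σ_{n≥0} (ωₙ² + E_k²)⁻²`,

`ωₙ = (2n+1)π/β`, `E_k² = (ε_L(k) − μ)² + 8h²ĝ_d(k)²`. Proof: `4[Re(Δ,Δ) − (Re⟨Δ⟩)²] = [Re(Φ₁,Φ₁) − (Re⟨Φ₁⟩)²] − Re(Φ₂,Φ₂)`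
(`longitudinal_sub_transverse_eq_four_mul_anomalous`) `= m′(h)/β − m(h)/(βh)` (linear response and the transverse
Ward identity) and the explicit mode sums of `m = β⁻¹ d/dt log Z` and `m′`. [folklore] -/
theorem fam_freeAnomalousMargin_eq :
    ∀ (β μ : ℝ), 0 < β → ∀ (L : ℕ) [NeZero L], 3 ≤ L → ∀ (h : ℝ), 0 < h → (Matrix.gibbsState β
    (Literature.MathematicalPhysics.QuantumLattice.dWaveSourceTorus L 0 μ h)
    (Literature.MathematicalPhysics.QuantumLattice.pairField
    Literature.MathematicalPhysics.QuantumLattice.dWaveFormFactor L)).re ^ 2 - (Matrix.duhamel β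
    (Literature.MathematicalPhysics.QuantumLattice.dWaveSourceTorus L 0 μ h)
    (Literature.MathematicalPhysics.QuantumLattice.pairField
    Literature.MathematicalPhysics.QuantumLattice.dWaveFormFactor L)
    (Literature.MathematicalPhysics.QuantumLattice.pairField
    Literature.MathematicalPhysics.QuantumLattice.dWaveFormFactor L)).re = 128 * h ^ 2 / β ^ 2 * ∑ k :
    Literature.Probability.LatticeModels.TorusSite 2 L, Literature.MathematicalPhysics.QuantumLattice.dWaveGap k
    ^ 4 * ∑' n : ℕ, 1 / (((2 * n + 1) * Real.pi / β) ^ 2 +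
    ((Literature.MathematicalPhysics.QuantumLattice.torusBand L k - μ) ^ 2 + 8 *
    Literature.MathematicalPhysics.QuantumLattice.dWaveGap k ^ 2 * h ^ 2)) ^ 2 := by
  intro β μ hβ L _ hL h hh
  set Qm := pairField dWaveFormFactor L with hQm
  have hHerm := isHermitian_hubbardTorusWith L 1 0 μ
  have hKHerm : (dWaveSourceTorus L 0 μ h).IsHermitian :=
    isHermitian_sub_smul hHerm (isHermitian_longitudinal Qm) h
  -- the four identities
  have hm' := hasDerivAt_re_gibbsState_source hHerm (isHermitian_longitudinal Qm) hβ h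
  have e1 := hm'.unique (fam_hasDerivAt_re_gibbsState_longitudinal hL hβ μ hh)
  have e0 := fam_beta_mul_re_gibbsState_longitudinal_eq hL hβ μ hh
  have hW := transverse_ward_identity hHerm (diagonal_card_commutator_hubbardTorusWith L 0 μ)
    (diagonal_card_commutator_pairField L) (diagonal_card_commutator_pairField_conjTranspose L) two_ne_zero hβ hh
  have e4 := longitudinal_sub_transverse_eq_four_mul_anomalous hKHerm β Qm
  -- names
  set S1 : TorusSite 2 L → ℝ := fun k =>
    ∑' n : ℕ, 1 / (((2 * n + 1) * π / β) ^ 2 + ((torusBand L k - μ) ^ 2 + 8 * dWaveGap k ^ 2 * h ^ 2)) with hS1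
  set S2 : TorusSite 2 L → ℝ := fun k =>
    ∑' n : ℕ, 1 / (((2 * n + 1) * π / β) ^ 2 + ((torusBand L k - μ) ^ 2 + 8 * dWaveGap k ^ 2 * h ^ 2)) ^ 2 with hS2
  set X : ℝ := ∑ k : TorusSite 2 L, 32 * dWaveGap k ^ 2 * S1 k with hX
  set Y : ℝ := ∑ k : TorusSite 2 L, dWaveGap k ^ 4 * S2 k with hY
  set D₁ := (duhamel β (dWaveSourceTorus L 0 μ h) (Qm + Qmᴴ) (Qm + Qmᴴ)).re with hD₁
  set D₂ := (duhamel β (dWaveSourceTorus L 0 μ h) (Complex.I • (Qmᴴ - Qm)) (Complex.I • (Qmᴴ - Qm))).re with hD₂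
  set m := (gibbsState β (dWaveSourceTorus L 0 μ h) (Qm + Qmᴴ)).re with hm
  set DQ := (duhamel β (dWaveSourceTorus L 0 μ h) Qm Qm).re with hDQ
  set mQ := (gibbsState β (dWaveSourceTorus L 0 μ h) Qm).re with hmQ
  have hsum0 : ∑ k : TorusSite 2 L, 32 * dWaveGap k ^ 2 * h * S1 k = h * X := by
    rw [hX, Finset.mul_sum]
    exact Finset.sum_congr rfl fun k _ => by ring
  have hsum1 : ∑ k : TorusSite 2 L, (32 * dWaveGap k ^ 2 * S1 k - 512 * dWaveGap k ^ 4 * h ^ 2 * S2 k) =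
      X - 512 * h ^ 2 * Y := by
    rw [Finset.sum_sub_distrib, hX, hY, Finset.mul_sum]
    congr 1
    exact Finset.sum_congr rfl fun k _ => by ring
  have E0 : β * m = h * X := by rw [← hsum0]; exact e0
  have E1 : β * (D₁ - m ^ 2) = β⁻¹ * (X - 512 * h ^ 2 * Y) := by rw [← hsum1]; exact e1
  have E2 : β * D₂ = m / h := hW
  have E4 : D₁ - m ^ 2 - D₂ = 4 * (DQ - mQ ^ 2) := e4
  have hβ0 : β ≠ 0 := hβ.ne'
  have hh0 : h ≠ 0 := hh.ne'
  have E2' : β ^ 2 * D₂ = X := by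
    have h1 : β ^ 2 * h * D₂ = h * X := by
      calc β ^ 2 * h * D₂ = β * h * (β * D₂) := by ring
        _ = β * h * (m / h) := by rw [E2]
        _ = β * m := by field_simp
        _ = h * X := E0
    have h2 : h * (β ^ 2 * D₂ - X) = 0 := by linear_combination h1
    have h3 := (mul_eq_zero.1 h2).resolve_left hh0
    linarith
  have E1' : β ^ 2 * (D₁ - m ^ 2) = X - 512 * h ^ 2 * Y := by
    have h1 : β * (β * (D₁ - m ^ 2)) = β * (β⁻¹ * (X - 512 * h ^ 2 * Y)) := by rw [E1]
    rw [← mul_assoc β β⁻¹, mul_inv_cancel₀ hβ0, one_mul] at h1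
    linear_combination h1
  rw [div_mul_eq_mul_div, eq_div_iff (pow_ne_zero 2 hβ0)]
  linear_combination (-(1 / 4 : ℝ)) * E1' + (1 / 4 : ℝ) * E2' + (β ^ 2 / 4) * E4

end Free

end Summit.HubbardSuperconductivity.HubbardSuperconductivity.Theorems.TwSeededEnsembleEquivalenceR
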